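import Mathlib.FieldTheory.IsAlgClosed.Basic
import Mathlib.FieldTheory.Separable
import Mathlib.RingTheory.AlgebraicIndependent.AlgebraicClosure
import Mathlib.RingTheory.AlgebraicIndependent.Transcendental
import Literature.NumberTheory.DiophantineGeometry.BertiniSubstitutionProofs
import Literature.NumberTheory.DiophantineGeometry.BertiniShapeProofs
import Literature.NumberTheory.DiophantineGeometry.BertiniLineRestrictionProofs
import Literature.RingTheory.MvPolynomial.KaltofenNoetherFormsProofs
import Literature.RingTheory.MvPolynomial.KaltofenNoetherFormsHenselProofs
import HarnessLib

/-!
# Towards Kaltofen's Theorem 7 (effective Noether forms): proofs, part 3 — Lemma 7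
# (the generic plane section of an absolutely irreducible polynomial is absolutely irreducible)

Sibling proof file of `KaltofenNoetherForms.lean` (E. Kaltofen, *Effective Noether
irreducibility forms and applications*, J. Comput. System Sci. 50 (1995) 274–295).

Kaltofen's **Lemma 7** (§5, p. 23, "established jointly with John F. Canny"): for `f`
absolutely irreducible of degree `d` in `n ≥ 2` variables over a field `K`, the bivariate
polynomial `φ₂(x, y) = f(x + v₁, w₂x + z₂y + v₂, …, wₙx + zₙy + vₙ)` over the purely
transcendental extension `K(v, w, z)` is absolutely irreducible (under the genericity
condition (33): leading `x`-coefficient a constant and `φ₂(x, 0)` squarefree). We prove it for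
the (equally generic) substitution `xᵢ ↦ μᵢ + vᵢ x + zᵢ y` of the tree's Bertini files:

* `irreducible_map_planeSubst_of_isAlgClosed` — over an ALGEBRAICALLY CLOSED field `E`: if
  `f ∈ E[x₁, …, xₙ]` is irreducible, `f_δ(v) ≠ 0` and `g(X) = f(μ + Xv)` is separable, then
  `χ = f(μ + vX + Y·Z) ∈ E[Z][Y][X]` stays irreducible in `Ω[Y][X]` for every field `Ω` into
  which `E[Z]` embeds (Kaltofen's Thm. 5, qualitative part, for the GENERIC `η = Z`: the
  tree's `irreducible_planeSubst` = Lemma 5, plus Hensel splitting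
  `irreducible_map_of_irreducible_of_simple_roots` in place of the algorithm);
* `irreducible_planeSection_of_algebraicIndependent` — over an ARBITRARY field `K`: for `f`
  absolutely irreducible and parameters `(μ, v, z) ∈ Ω^{3n}` algebraically independent over
  `K` in an algebraically closed `Ω ⊇ K`, with `f_δ(v) ≠ 0` and `f(μ + Xv)` separable, the
  section `f(μ + vX + zY) ∈ Ω[Y][X]` is irreducible (Lemma 7 proper: pass to the algebraic
  closure `k₁` of `K(μ, v)` in `Ω`, over which `z` stays algebraically independent, Mathlib's
  `AlgebraicIndependent.algebraicClosure`, and `f` stays irreducible,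
  `IsAbsIrreducible.irreducible_map`).

No definitions, no named facts.

## References

* E. Kaltofen, J. Comput. System Sci. 50 (1995) 274–295, §4 Lemma 5, Thm. 5; §5 Lemma 7.
  [Kaltofen1995]
-/

noncomputable section

open MvPolynomial
open scoped Polynomial

universe u v

namespace Literature.RingTheory.MvPolynomial

open Literature.NumberTheory.DiophantineGeometry

/-! ### Over an algebraically closed field -/

section AlgClosed

variable {E : Type u} [Field E] {n : ℕ}

/-- An irreducible polynomial over a field has positive total degree. [folklore] -/
theorem totalDegree_pos_of_irreducible {σ : Type*} {f : MvPolynomial σ E} (hf : Irreducible f) :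
    0 < f.totalDegree := by
  by_contra h
  have h0 : f.totalDegree = 0 := by omega
  rw [totalDegree_eq_zero_iff_eq_C] at h0
  rcases eq_or_ne (f.coeff 0) 0 with hc | hc
  · exact hf.ne_zero (by rw [h0, hc, C_0])
  · exact hf.not_isUnit (by rw [h0]; exact (Ne.isUnit hc).map C)

/-- **Kaltofen's Theorem 5 / Lemma 7 over an algebraically closed field (qualitative, generic
`η`).** Let `E` be algebraically closed, `f ∈ E[x₁, …, xₙ]` irreducible, `μ, v ∈ Eⁿ` with
`f_δ(v) ≠ 0` (the line direction is not asymptotic) and `g(X) = f(μ + Xv)` separable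
(condition (33)). Then `χ = f(μ + vX + Y·Z) ∈ E[Z][Y][X]` is irreducible in `Ω[Y][X]` for
every field `Ω` and every injective `ι : E[Z] → Ω` — in particular absolutely irreducible over
`E(Z)`. [cite: Kaltofen1995, §4 Thm. 5, §5 Lemma 7] -/
theorem irreducible_map_planeSubst_of_isAlgClosed [IsAlgClosed E] {f : MvPolynomial (Fin n) E}
    (hf : Irreducible f) (μ v : Fin n → E)
    (hv : MvPolynomial.eval v (homogeneousComponent f.totalDegree f) ≠ 0)
    (hsep : (MvPolynomial.aeval (fun i ↦ Polynomial.C (μ i) + Polynomial.C (v i) * Polynomial.X :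
      Fin n → E[X]) f).Separable)
    {Ω : Type v} [Field Ω] (ι : MvPolynomial (Fin n) E →+* Ω) (hι : Function.Injective ι) :
    Irreducible ((MvPolynomial.aeval (fun i ↦
      (Polynomial.C (Polynomial.C (MvPolynomial.C (μ i))) +
        Polynomial.C (Polynomial.C (MvPolynomial.C (v i))) * Polynomial.X +
        Polynomial.C (Polynomial.C (MvPolynomial.X i) * Polynomial.X) :
          Polynomial (Polynomial (MvPolynomial (Fin n) E)))) f).map (Polynomial.mapRingHom ι)) := by
  classical
  set δ := f.totalDegree with hδ_def
  set g : E[X] := MvPolynomial.aeval (fun i ↦ Polynomial.C (μ i) + Polynomial.C (v i) *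
    Polynomial.X : Fin n → E[X]) f with hg_def
  set χ : Polynomial (Polynomial (MvPolynomial (Fin n) E)) := MvPolynomial.aeval (fun i ↦
      (Polynomial.C (Polynomial.C (MvPolynomial.C (μ i))) +
        Polynomial.C (Polynomial.C (MvPolynomial.C (v i))) * Polynomial.X +
        Polynomial.C (Polynomial.C (MvPolynomial.X i) * Polynomial.X) :
          Polynomial (Polynomial (MvPolynomial (Fin n) E)))) f with hχ_def
  have hδ : 0 < δ := totalDegree_pos_of_irreducible hf
  -- `g` has degree `δ` with leading coefficient `f_δ(v)`
  have hgcoeff : g.coeff δ = MvPolynomial.eval v (homogeneousComponent δ f) :=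
    coeff_map_eval_lineRestrict_totalDegree f μ v
  have hgdeg : g.natDegree = δ :=
    le_antisymm (natDegree_map_eval_lineRestrict_le f μ v)
      (Polynomial.le_natDegree_of_ne_zero (by rwa [hgcoeff]))
  have hg0 : g ≠ 0 := fun h => hv (by rw [← hgcoeff, h, Polynomial.coeff_zero])
  -- `χ` is irreducible (Lemma 5) of `X`-degree `δ` with constant unit leading coefficient
  have hirr : Irreducible χ := irreducible_planeSubst hf μ v hg0
  have hχcoeff : χ.coeff δ = Polynomial.C (C (MvPolynomial.eval v (homogeneousComponent δ f))) :=
    coeff_planeSubst_totalDegree f μ v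
  have hχdeg : χ.natDegree = δ := by
    refine le_antisymm (natDegree_planeSubst_le f μ v) (Polynomial.le_natDegree_of_ne_zero ?_)
    rw [hχcoeff]
    exact Polynomial.C_ne_zero.2 (C_ne_zero.2 hv)
  have hlc : χ.leadingCoeff = Polynomial.C (C (MvPolynomial.eval v (homogeneousComponent δ f))) := by
    rw [Polynomial.leadingCoeff, hχdeg, hχcoeff]
  have hℓ : IsUnit (C (MvPolynomial.eval v (homogeneousComponent δ f)) : MvPolynomial (Fin n) E) :=
    (Ne.isUnit hv).map C
  -- reduction modulo `Y`: `χ(X, 0) = g`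
  have hred : χ.map (Polynomial.evalRingHom (0 : MvPolynomial (Fin n) E)) =
      g.map (C : E →+* MvPolynomial (Fin n) E) := map_evalRingHom_zero_planeSubst f μ v
  -- the `δ` distinct simple roots of `g`, viewed in `E[Z]`
  set S : Finset (MvPolynomial (Fin n) E) := g.roots.toFinset.image (C : E → MvPolynomial (Fin n) E)
    with hS_def
  have hScard : S.card = χ.natDegree := by
    rw [hS_def, Finset.card_image_of_injective _ (C_injective (Fin n) E),
      Multiset.toFinset_card_of_nodup (Polynomial.nodup_roots hsep), hχdeg, ← hgdeg]
    exact IsAlgClosed.card_roots_eq_natDegree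
  have hmemS : ∀ ζ' ∈ S, ∃ ζ : E, ζ ∈ g.roots ∧ ζ' = C ζ := by
    intro ζ' hζ'
    obtain ⟨ζ, hζ, rfl⟩ := Finset.mem_image.1 hζ'
    exact ⟨ζ, Multiset.mem_toFinset.1 hζ, rfl⟩
  have h0 : ∀ ζ' ∈ S, (χ.map (Polynomial.evalRingHom (0 : MvPolynomial (Fin n) E))).IsRoot ζ' := by
    intro ζ' hζ'
    obtain ⟨ζ, hζ, rfl⟩ := hmemS ζ' hζ'
    rw [hred, Polynomial.IsRoot, Polynomial.eval_map, Polynomial.eval₂_at_apply,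
      ((Polynomial.mem_roots hg0).1 hζ).eq_zero, map_zero]
  have h1 : ∀ ζ' ∈ S, IsUnit ((χ.map (Polynomial.evalRingHom
      (0 : MvPolynomial (Fin n) E))).derivative.eval ζ') := by
    intro ζ' hζ'
    obtain ⟨ζ, hζ, rfl⟩ := hmemS ζ' hζ'
    rw [hred, Polynomial.derivative_map, Polynomial.eval_map, Polynomial.eval₂_at_apply]
    refine (Ne.isUnit ?_).map C
    have hroot : Polynomial.aeval ζ g = 0 := by
      rw [Polynomial.coe_aeval_eq_eval]; exact (Polynomial.mem_roots hg0).1 hζ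
    have := hsep.aeval_derivative_ne_zero hroot
    rwa [Polynomial.coe_aeval_eq_eval] at this
  exact irreducible_map_of_irreducible_of_simple_roots hirr hℓ hlc S hScard h0 h1 ι hι

end AlgClosed

/-! ### Over an arbitrary field: Lemma 7 -/

section AnyField

variable {K : Type u} [Field K] {n : ℕ}

/-- Ring-hom bookkeeping: pushing the generic section over `k₁[Z]` along `Z ↦ z` gives the
section over `Ω` with constant parameters. [folklore] -/
theorem map_mapRingHom_aeval_planeSubst {k₁ : Type*} [Field k₁] {Ω : Type*} [Field Ω] [Algebra K Ω]
    (φ : K →+* k₁) (ψ : k₁ →+* Ω) (hφψ : ψ.comp φ = algebraMap K Ω) (f : MvPolynomial (Fin n) K)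
    (μ₁ v₁ : Fin n → k₁) (z : Fin n → Ω) :
    ((MvPolynomial.aeval (fun i ↦
      (Polynomial.C (Polynomial.C (MvPolynomial.C (μ₁ i))) +
        Polynomial.C (Polynomial.C (MvPolynomial.C (v₁ i))) * Polynomial.X +
        Polynomial.C (Polynomial.C (MvPolynomial.X i) * Polynomial.X) :
          Polynomial (Polynomial (MvPolynomial (Fin n) k₁)))) (f.map φ)).map
      (Polynomial.mapRingHom (MvPolynomial.eval₂Hom ψ z))) =
    MvPolynomial.aeval (fun i ↦
      (Polynomial.C (Polynomial.C (ψ (μ₁ i))) + Polynomial.C (Polynomial.C (ψ (v₁ i))) * Polynomial.X +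
        Polynomial.C (Polynomial.C (z i) * Polynomial.X) : Polynomial (Polynomial Ω))) f := by
  set ι : MvPolynomial (Fin n) k₁ →+* Ω := MvPolynomial.eval₂Hom ψ z with hι
  have hιC : ∀ a : k₁, ι (C a) = ψ a := fun a => by simp [hι]
  have hιX : ∀ i, ι (X i) = z i := fun i => by simp [hι]
  have hKΩ : ∀ a : K, ψ (φ a) = algebraMap K Ω a := fun a => by
    rw [← hφψ, RingHom.comp_apply]
  have key : (Polynomial.mapRingHom (Polynomial.mapRingHom ι)).comp
      ((MvPolynomial.aeval (fun i ↦
        (Polynomial.C (Polynomial.C (MvPolynomial.C (μ₁ i))) +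
          Polynomial.C (Polynomial.C (MvPolynomial.C (v₁ i))) * Polynomial.X +
          Polynomial.C (Polynomial.C (MvPolynomial.X i) * Polynomial.X) :
            Polynomial (Polynomial (MvPolynomial (Fin n) k₁))))).toRingHom.comp (MvPolynomial.map φ)) =
      (MvPolynomial.aeval (fun i ↦
        (Polynomial.C (Polynomial.C (ψ (μ₁ i))) + Polynomial.C (Polynomial.C (ψ (v₁ i))) * Polynomial.X +
          Polynomial.C (Polynomial.C (z i) * Polynomial.X) : Polynomial (Polynomial Ω)))).toRingHom := by
    refine MvPolynomial.ringHom_ext (fun a ↦ ?_) (fun i ↦ ?_)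
    · simp only [RingHom.coe_comp, Function.comp_apply, MvPolynomial.map_C, AlgHom.toRingHom_eq_coe,
        RingHom.coe_coe, MvPolynomial.algHom_C, Polynomial.algebraMap_apply,
        MvPolynomial.algebraMap_eq, Polynomial.coe_mapRingHom, Polynomial.map_C, hιC, hKΩ]
    · simp only [RingHom.coe_comp, Function.comp_apply, MvPolynomial.map_X, AlgHom.toRingHom_eq_coe,
        RingHom.coe_coe, MvPolynomial.aeval_X, Polynomial.coe_mapRingHom, Polynomial.map_add,
        Polynomial.map_mul, Polynomial.map_C, Polynomial.map_X, hιC, hιX]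
  exact DFunLike.congr_fun key f

/-- Ring-hom bookkeeping for the line `g(X) = f(μ + Xv)`. [folklore] -/
theorem map_aeval_line {k₁ : Type*} [Field k₁] {Ω : Type*} [Field Ω] [Algebra K Ω]
    (φ : K →+* k₁) (ψ : k₁ →+* Ω) (hφψ : ψ.comp φ = algebraMap K Ω) (f : MvPolynomial (Fin n) K)
    (μ₁ v₁ : Fin n → k₁) :
    (MvPolynomial.aeval (fun i ↦ Polynomial.C (μ₁ i) + Polynomial.C (v₁ i) * Polynomial.X :
      Fin n → k₁[X]) (f.map φ)).map ψ =
    MvPolynomial.aeval (fun i ↦ Polynomial.C (ψ (μ₁ i)) + Polynomial.C (ψ (v₁ i)) * Polynomial.X :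
      Fin n → Ω[X]) f := by
  have hKΩ : ∀ a : K, ψ (φ a) = algebraMap K Ω a := fun a => by
    rw [← hφψ, RingHom.comp_apply]
  have key : (Polynomial.mapRingHom ψ).comp
      (((MvPolynomial.aeval (fun i ↦ Polynomial.C (μ₁ i) + Polynomial.C (v₁ i) * Polynomial.X :
        Fin n → k₁[X])).toRingHom.comp (MvPolynomial.map φ))) =
      (MvPolynomial.aeval (fun i ↦ Polynomial.C (ψ (μ₁ i)) + Polynomial.C (ψ (v₁ i)) * Polynomial.X :
        Fin n → Ω[X])).toRingHom := by
    refine MvPolynomial.ringHom_ext (fun a ↦ ?_) (fun i ↦ ?_)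
    · simp only [RingHom.coe_comp, Function.comp_apply, MvPolynomial.map_C, AlgHom.toRingHom_eq_coe,
        RingHom.coe_coe, MvPolynomial.algHom_C, Polynomial.algebraMap_apply, Algebra.algebraMap_self_apply,
        Polynomial.coe_mapRingHom, Polynomial.map_C, hKΩ]
    · simp only [RingHom.coe_comp, Function.comp_apply, MvPolynomial.map_X, AlgHom.toRingHom_eq_coe,
        RingHom.coe_coe, MvPolynomial.aeval_X, Polynomial.coe_mapRingHom, Polynomial.map_add,
        Polynomial.map_mul, Polynomial.map_C, Polynomial.map_X]
  exact DFunLike.congr_fun key f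

/-- Ring-hom bookkeeping for values: `ψ(p^φ(v₁)) = p(ψ ∘ v₁)`. [folklore] -/
theorem map_eval_map {k₁ : Type*} [Field k₁] {Ω : Type*} [Field Ω] [Algebra K Ω]
    (φ : K →+* k₁) (ψ : k₁ →+* Ω) (hφψ : ψ.comp φ = algebraMap K Ω) {σ : Type*}
    (p : MvPolynomial σ K) (v₁ : σ → k₁) :
    ψ (MvPolynomial.eval v₁ (p.map φ)) = MvPolynomial.aeval (fun i => ψ (v₁ i)) p := by
  rw [MvPolynomial.eval_map, MvPolynomial.eval₂_comp_left, hφψ, MvPolynomial.aeval_def]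
  rfl

/-- **Kaltofen's Lemma 7 (qualitative form): the generic plane section of an absolutely
irreducible polynomial is absolutely irreducible.** Let `f ∈ K[x₁, …, xₙ]` be absolutely
irreducible, `Ω ⊇ K` algebraically closed and `(μ, v, z) ∈ Ω^{3n}` algebraically independent
over `K` (e.g. the indeterminates of `K(μ, v, z)` inside an algebraic closure). If the line
direction satisfies `f_δ(v) ≠ 0` and `f(μ + Xv)` is separable (Kaltofen's condition (33),
which holds generically), then the section `f(μ + vX + zY) ∈ Ω[Y][X]` is irreducible.
Proof: let `k₁` be the algebraic closure of `K(μ, v)` in `Ω`; `f` stays irreducible over `k₁`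
(`IsAbsIrreducible.irreducible_map`), `z` stays algebraically independent over `k₁`
(`AlgebraicIndependent.algebraicClosure`), i.e. `k₁[Z] → Ω`, `Z ↦ z` is injective, and
`irreducible_map_planeSubst_of_isAlgClosed` applies. [cite: Kaltofen1995, §5 Lemma 7] -/
theorem irreducible_planeSection_of_algebraicIndependent {f : MvPolynomial (Fin n) K}
    (hf : IsAbsIrreducible f) {Ω : Type v} [Field Ω] [IsAlgClosed Ω] [Algebra K Ω]
    (μ v z : Fin n → Ω) (hind : AlgebraicIndependent K (Sum.elim z (Sum.elim μ v)))
    (hv : MvPolynomial.aeval v (homogeneousComponent f.totalDegree f) ≠ 0)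
    (hsep : (MvPolynomial.aeval (fun i ↦ Polynomial.C (μ i) + Polynomial.C (v i) * Polynomial.X :
      Fin n → Ω[X]) f).Separable) :
    Irreducible (MvPolynomial.aeval (fun i ↦
      (Polynomial.C (Polynomial.C (μ i)) + Polynomial.C (Polynomial.C (v i)) * Polynomial.X +
        Polynomial.C (Polynomial.C (z i) * Polynomial.X) : Polynomial (Polynomial Ω))) f) := by
  classical
  -- the field `k₀ = K(μ, v)` and its algebraic closure `k₁` inside `Ω`
  set s : Set Ω := Set.range (Sum.elim μ v) with hs_def
  set k₀ : IntermediateField K Ω := IntermediateField.adjoin K s with hk₀_def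
  set k₁ : IntermediateField k₀ Ω := algebraicClosure k₀ Ω with hk₁_def
  haveI : IsAlgClosed k₁ := IsAlgClosure.isAlgClosed k₀
  -- `z` is algebraically independent over `k₁`
  have hz₀ : AlgebraicIndependent (Algebra.adjoin K s) z := (AlgebraicIndependent.sumElim_iff.1 hind).2
  have hz₁ : AlgebraicIndependent k₀ z := IntermediateField.algebraicIndependent_adjoin_iff.2 hz₀
  have hz₂ : AlgebraicIndependent k₁ z := hz₁.algebraicClosure
  -- parameters inside `k₁`
  have hmem : ∀ x ∈ s, x ∈ k₁ := by
    intro x hx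
    have hx₀ : x ∈ k₀ := IntermediateField.subset_adjoin K s hx
    rw [hk₁_def, mem_algebraicClosure_iff]
    have : x = algebraMap k₀ Ω ⟨x, hx₀⟩ := rfl
    rw [this]
    exact isAlgebraic_algebraMap _
  have hμ : ∀ i, μ i ∈ k₁ := fun i => hmem _ ⟨Sum.inl i, rfl⟩
  have hvm : ∀ i, v i ∈ k₁ := fun i => hmem _ ⟨Sum.inr i, rfl⟩
  set μ₁ : Fin n → k₁ := fun i => ⟨μ i, hμ i⟩ with hμ₁_def
  set v₁ : Fin n → k₁ := fun i => ⟨v i, hvm i⟩ with hv₁_def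
  -- the ring maps `K → k₁ → Ω`
  set ψ : (k₁ : Type v) →+* Ω := algebraMap k₁ Ω with hψ_def
  set φ : K →+* (k₁ : Type v) := (algebraMap k₀ k₁).comp (algebraMap K k₀) with hφ_def
  have hφψ : ψ.comp φ = algebraMap K Ω := by
    refine RingHom.ext fun a => ?_
    change algebraMap k₁ Ω (algebraMap k₀ k₁ (algebraMap K k₀ a)) = algebraMap K Ω a
    rw [← IsScalarTower.algebraMap_apply k₀ k₁ Ω, ← IsScalarTower.algebraMap_apply K k₀ Ω]
  -- `f` over `k₁`
  set f₁ : MvPolynomial (Fin n) k₁ := f.map φ with hf₁_def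
  have hf₁ : Irreducible f₁ := hf.irreducible_map φ
  have hdeg₁ : f₁.totalDegree = f.totalDegree := totalDegree_map_of_injective' f φ.injective
  -- the embedding `k₁[Z] → Ω`, `Z ↦ z`
  set ι : MvPolynomial (Fin n) k₁ →+* Ω := MvPolynomial.eval₂Hom ψ z with hι_def
  have hι : Function.Injective ι := by
    have : (ι : MvPolynomial (Fin n) k₁ → Ω) =
        (MvPolynomial.aeval z : MvPolynomial (Fin n) k₁ →ₐ[k₁] Ω) := by
      funext p
      rw [hι_def, MvPolynomial.aeval_def, coe_eval₂Hom]
    rw [this]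
    exact hz₂
  -- transfer of the two genericity hypotheses
  have hv' : MvPolynomial.eval v₁ (homogeneousComponent f₁.totalDegree f₁) ≠ 0 := by
    intro h0
    apply hv
    have h1 := congrArg ψ h0
    rw [map_zero, hdeg₁, hf₁_def, homogeneousComponent_map, map_eval_map φ ψ hφψ] at h1
    exact h1
  have hsep' : (MvPolynomial.aeval (fun i ↦ Polynomial.C (μ₁ i) + Polynomial.C (v₁ i) *
      Polynomial.X : Fin n → k₁[X]) f₁).Separable := by
    rw [← Polynomial.separable_map ψ, hf₁_def, map_aeval_line φ ψ hφψ]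
    exact hsep
  have hmain := irreducible_map_planeSubst_of_isAlgClosed hf₁ μ₁ v₁ hv' hsep' ι hι
  rwa [hf₁_def, hι_def, map_mapRingHom_aeval_planeSubst φ ψ hφψ] at hmain

end AnyField

end Literature.RingTheory.MvPolynomial

end
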